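import Literature.NumberTheory.Automorphic.UnitaryThreeLevelTwoHeisenbergClasses   -- (A2, this hand): the two population-blind level-2 class theorems; brings (A1) bookkeeping, ★ T4′-GEN `isIntMatrix_*`, ★ p08 currency
import Literature.NumberTheory.Automorphic.HyperspecialUnitaryCartan                -- ★ `UnramifiedLocalConjDatum.exists_cartan_antidiagonal` (Tits 1979 §3.3.3)
import HarnessLib

/-!
# Boundary rigidity at level two for the hyperspecial unitary group in three variables (architect A-83 «RIGID-2»; Rogawski 1990 §3.9, Tits 1979 §3.3.3)

Topic `NumberTheory/Automorphic`; namespace `Literature.NumberTheory.Automorphic.UnitaryGroup`.  THEOREMS ONLY (no definition, no instance, no notation, no named fact,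
no `sorry`).  Cell `pub/hodgecm-mathlib`, road «S3-tree», crux H413 = `stmt-HodgeConjecture-24833`; architect A-p16 (g29) A-83 / memo `RIGIDITY-boundary-levels` 6ee39f5a
(«boundary rigidity holds at level 2 and fails at every level j ≥ 3»), hand F0P3-p03 (g13); file (B) = the geometric statement, over (A1)(A2).

SETTING as in (A1): valued field `K`, ★ `UnramifiedLocalConjDatum σ ϖ`, `J₀ = antidiag(1,1,1)`, `U = U(σ, J₀)`, `K₀ = U ∩ GL₃(𝒪)`, «`≡ (mod ϖ²)`» = `IsIntMatrix ((ϖ ^ 2)⁻¹ • (· − ·))`.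
A `γ ∈ U` is `2`-DEEP at the standard hyperspecial vertex `𝒪³` when `γ ≡ 1 (mod ϖ²)`; a hyperspecial vertex `y = g·𝒪³` (`g ∈ U`) is `γ`-FIXED when the local element
`x = g⁻¹ γ g` is integral (then `x ∈ K₀`); `y` is a BOUNDARY vertex of transvection (resp. regular) type when `x̄ − 1` is square-zero non-zero (resp. `(x̄ − 1)² ≠ 0`).

* §1 `isIntMatrix_smul_conj_sub_one_sq`, `isIntMatrix_smul_conj_sub_one`
  (transport of the residual Jordan type along `K₀`); **`isIntMatrix_inv_smul_sub_one_sq_iff_of_near_heisenberg`** (`y ≡ u(α,β)` ⇒ [`(ȳ−1)² = 0` ⟺ `v(ασα) ≤ v ϖ`]),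
  `v_corner_eq_one_of_near_heisenberg` (`v α < 1`, `ȳ ≠ 1` ⇒ `β` a unit).
* §2 **`exists_near_heisenberg_of_diag_conj`** (core: `diag(e)⁻¹ γ′ diag(e) ≡ u(y₀₁, y₀₂)` for `γ′ ≡ 1`, `e = (e₀, ±1, e₀⁻¹)`, `v e₀ ≤ 1`) and the BRIDGE
  **`exists_levelTwo_conj_near_heisenberg_of_two_deep`**: `γ` 2-deep, `g ∈ U`, `x = g⁻¹γg` integral ⇒ `∃ k ∈ K₀, k x k⁻¹ ≡ u(α, β) (mod ϖ²)` (Cartan ★ `k₁ g k₂ = diag d`,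
  flip by `w` when `v d₀ > 1`) — the apartment normal form of the memo §2 at `j = 2`.
* §3 **`levelTwo_conj_cornerUnipotent_of_two_deep`** (RIGID-2, transvection type: `≡ n(t₀)` for every skew unit `t₀`, given residual norm surjectivity `hN`) and
  **`levelTwo_conj_upperUnipotent_one_of_two_deep`** (RIGID-2, regular type: `≡ u(1, b₀)`, no norm hypothesis): for a `2`-deep `γ` EVERY boundary vertex of a given residual
  type carries ONE AND THE SAME `U(𝒪∕ϖ²)`-class.
* §4 `isIntMatrix_smul_mul_inv_sub_one`, `isIntMatrix_smul_inv_mul_sub_one` — adapter `y ≡ n ⇒ y = u n = n u′` with `u, u′ ≡ 1` (for level-2 class functions).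
  NOT claimed: anything at level `≥ 3` (false by the memo §3 (ii)) or at a ramified place.
HONEST LABEL: HC_CM is proved only modulo the printed citations (2 remaining named inputs hLiu418, h413) until rung 0 closes; this file is elementary matrix algebra over a valued field.

## References
* [Rogawski1990] J. D. Rogawski, *Automorphic Representations of Unitary Groups in Three Variables*, Ann. of Math. Stud. 123 (1990): §1.10 p. 9, §3.9 p. 32, Prop. 3.9.1.
* [Tits1979] J. Tits, *Reductive groups over local fields*, Proc. Sympos. Pure Math. 33.1 (1979): §3.3.3 (hyperspecial `K₀`, Cartan decomposition), §3.5 (congruence filtration).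
-/

set_option autoImplicit false

open Matrix
open scoped Valued WithZero Matrix MatrixGroups

namespace Literature.NumberTheory.Automorphic.UnitaryGroup

open Literature.NumberTheory.Automorphic Literature.NumberTheory.Automorphic.HermitianLattice Literature.NumberTheory.Automorphic.UnitaryLatticeTree

variable {K : Type*} [Field K] [Valued K ℤᵐ⁰]

/-! ## §1 Conjugation of congruences; residual types of near-Heisenberg elements (the flip `w = J₀` is ★ `exists_units_coe_eq_antidiagPerm`) -/

/-- **Conjugating the square at level one**: if `(x − 1)²` is `c`-integral then so is `(k x k′ − 1)²` for `k k′ = k′ k = 1` integral. [cite: Tits1979, §3.5] -/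
theorem isIntMatrix_smul_conj_sub_one_sq {N : ℕ} (c : K) {k k' x : Matrix (Fin N) (Fin N) K} (hk : IsIntMatrix k) (hk' : IsIntMatrix k')
    (h1 : k * k' = 1) (h2 : k' * k = 1) (hx : IsIntMatrix (c • (x - 1) ^ 2)) : IsIntMatrix (c • (k * x * k' - 1) ^ 2) := by
  have h : c • (k * x * k' - 1) ^ 2 = k * (c • (x - 1) ^ 2) * k' := by
    rw [show k * x * k' - 1 = k * (x - 1) * k' by rw [Matrix.mul_sub, Matrix.sub_mul, Matrix.mul_one, h1], sq, sq,
      show k * (x - 1) * k' * (k * (x - 1) * k') = k * ((x - 1) * (k' * k) * (x - 1)) * k' by noncomm_ring, h2, Matrix.mul_one,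
      Matrix.mul_smul, Matrix.smul_mul]
  rw [h]; exact isIntMatrix_mul (isIntMatrix_mul hk hx) hk'

/-- **Conjugating a congruence to `1`**: `x ≡ 1 (mod c⁻¹)` ⇒ `k x k′ ≡ 1` for `k k′ = 1` integral. [cite: Tits1979, §3.5] -/
theorem isIntMatrix_smul_conj_sub_one {N : ℕ} (c : K) {k k' x : Matrix (Fin N) (Fin N) K} (hk : IsIntMatrix k) (hk' : IsIntMatrix k')
    (h1 : k * k' = 1) (hx : IsIntMatrix (c • (x - 1))) : IsIntMatrix (c • (k * x * k' - 1)) :=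
  isIntMatrix_smul_conj_sub c hk hk' hx (by rw [Matrix.mul_one, h1, sub_self, smul_zero]; exact isIntMatrix_zero)

/-- **The residual square of a near-Heisenberg element**: if `y ≡ u(α, β) (mod ϖ²)` (`α, β` integral) then `(y − 1)²` is `ϖ⁻¹`-integral iff `v(α σα) ≤ v ϖ` — because
`(u(α,β) − 1)² = −ασα·E₀₂` (★ `upperUnipotent_sub_one_mul_self`) and the cross terms are `O(ϖ²)`. [cite: Rogawski1990, §3.9 p. 32] [cite: Tits1979, §3.5] -/
theorem isIntMatrix_inv_smul_sub_one_sq_iff_of_near_heisenberg {σ : K →+* K} {ϖ : K} (hd : UnramifiedLocalConjDatum σ ϖ)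
    {y : Matrix (Fin 3) (Fin 3) K} {α β : K} (hα : Valued.v α ≤ 1) (hβ : Valued.v β ≤ 1)
    (hy : IsIntMatrix ((ϖ ^ 2)⁻¹ • (y - !![1, α, β; 0, 1, -σ α; 0, 0, 1]))) :
    IsIntMatrix (ϖ⁻¹ • (y - 1) ^ 2) ↔ Valued.v (α * σ α) ≤ Valued.v ϖ := by
  obtain ⟨hϖ0, hϖ2, hvϖ1, hP1, -⟩ := ϖ_facts hd
  set U : Matrix (Fin 3) (Fin 3) K := !![1, α, β; 0, 1, -σ α; 0, 0, 1] with hU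
  obtain ⟨T, hT⟩ : ∃ T : Matrix (Fin 3) (Fin 3) K, y - U = T := ⟨_, rfl⟩
  rw [hT] at hy
  have hTint : IsIntMatrix (ϖ⁻¹ • T) := by
    rw [show ϖ⁻¹ • T = ϖ • ((ϖ ^ 2)⁻¹ • T) by rw [smul_smul]; congr 1; field_simp]
    exact isIntMatrix_smul_of_v_le_one hvϖ1.le hy
  have hTint' : IsIntMatrix T := by
    rw [show T = ϖ • (ϖ⁻¹ • T) by rw [smul_smul, mul_inv_cancel₀ hϖ0, one_smul]]; exact isIntMatrix_smul_of_v_le_one hvϖ1.le hTint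
  have hU1 : IsIntMatrix (U - 1) := by
    intro i j; fin_cases i <;> fin_cases j <;> simp [hU, hα, hβ, hd.vσ]
  have hdec : ϖ⁻¹ • (y - 1) ^ 2 = ϖ⁻¹ • (U - 1) ^ 2 + ((U - 1) * (ϖ⁻¹ • T) + (ϖ⁻¹ • T) * (U - 1) + (ϖ⁻¹ • T) * T) := by
    rw [show y = U + T by rw [← hT, add_sub_cancel], Matrix.mul_smul, Matrix.smul_mul, Matrix.smul_mul, ← smul_add, ← smul_add, ← smul_add, sq, sq]
    congr 1; noncomm_ring
  have hR : IsIntMatrix ((U - 1) * (ϖ⁻¹ • T) + (ϖ⁻¹ • T) * (U - 1) + (ϖ⁻¹ • T) * T) :=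
    isIntMatrix_add (isIntMatrix_add (isIntMatrix_mul hU1 hTint) (isIntMatrix_mul hTint hU1)) (isIntMatrix_mul hTint hTint')
  have hsq : (U - 1) ^ 2 = !![0, 0, α * (-σ α); 0, 0, 0; 0, 0, 0] := by rw [sq, hU]; exact upperUnipotent_sub_one_mul_self α β (-σ α)
  have hiff : IsIntMatrix (ϖ⁻¹ • (y - 1) ^ 2) ↔ IsIntMatrix (ϖ⁻¹ • (U - 1) ^ 2) := by
    rw [hdec]
    refine ⟨fun h => ?_, fun h => isIntMatrix_add h hR⟩
    have h' := isIntMatrix_sub h hR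
    rwa [add_sub_cancel_right] at h'
  rw [hiff, hsq, isIntMatrix_inv_smul_iff hϖ0]
  constructor
  · intro h
    have h02 := h 0 2
    rw [show (!![0, 0, α * (-σ α); 0, 0, 0; 0, 0, 0] : Matrix (Fin 3) (Fin 3) K) 0 2 = α * (-σ α) from rfl, mul_neg, Valuation.map_neg] at h02
    exact h02
  · intro h i j
    fin_cases i <;> fin_cases j <;> first | (show Valued.v (α * (-σ α)) ≤ _; rw [mul_neg, Valuation.map_neg]; exact h) | simp

/-- **The residual corner of a near-singular element**: if `y ≡ u(α, β) (mod ϖ²)` with `v α < 1` and `y ≢ 1 (mod ϖ)`, then `β` is a unit. [cite: Rogawski1990, §3.9 p. 32] -/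
theorem v_corner_eq_one_of_near_heisenberg {σ : K →+* K} {ϖ : K} (hd : UnramifiedLocalConjDatum σ ϖ)
    {y : Matrix (Fin 3) (Fin 3) K} {α β : K} (hα : Valued.v α < 1) (hβ : Valued.v β ≤ 1)
    (hy : IsIntMatrix ((ϖ ^ 2)⁻¹ • (y - !![1, α, β; 0, 1, -σ α; 0, 0, 1]))) (h1 : ¬ IsIntMatrix (ϖ⁻¹ • (y - 1))) : Valued.v β = 1 := by
  obtain ⟨hϖ0, hϖ2, hvϖ1, hP1, -⟩ := ϖ_facts hd
  by_contra hβ1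
  have hβϖ : Valued.v β ≤ Valued.v ϖ := v_le_ϖ_of_lt_one hd (lt_of_le_of_ne hβ hβ1)
  have hαϖ : Valued.v α ≤ Valued.v ϖ := v_le_ϖ_of_lt_one hd hα
  apply h1
  set U : Matrix (Fin 3) (Fin 3) K := !![1, α, β; 0, 1, -σ α; 0, 0, 1] with hU
  obtain ⟨T, hT⟩ : ∃ T : Matrix (Fin 3) (Fin 3) K, y - U = T := ⟨_, rfl⟩
  rw [hT] at hy
  have hTint : IsIntMatrix (ϖ⁻¹ • T) := by
    rw [show ϖ⁻¹ • T = ϖ • ((ϖ ^ 2)⁻¹ • T) by rw [smul_smul]; congr 1; field_simp]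
    exact isIntMatrix_smul_of_v_le_one hvϖ1.le hy
  have hdec : ϖ⁻¹ • (y - 1) = ϖ⁻¹ • (U - 1) + ϖ⁻¹ • T := by
    rw [← smul_add]; congr 1; rw [← hT]; abel
  rw [hdec]
  refine isIntMatrix_add ?_ hTint
  have hU1 : U - 1 = !![0, α, β; 0, 0, -σ α; 0, 0, 0] := by
    rw [hU]; ext i j; fin_cases i <;> fin_cases j <;> simp
  rw [isIntMatrix_inv_smul_iff hϖ0, hU1]
  have hσα : Valued.v (-σ α) ≤ Valued.v ϖ := by rw [Valuation.map_neg, hd.vσ]; exact hαϖ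
  intro i j
  fin_cases i <;> fin_cases j <;> first | exact hαϖ | exact hβϖ | exact hσα | simp

/-! ## §2 The apartment normal form modulo `ϖ²` (Cartan bridge) -/

/-- **CORE OF THE BRIDGE**: if `γ′ ≡ 1 (mod ϖ²)`, `e = (e₀, e₁, e₀⁻¹)` with `e₁² = 1`, `v e₀ ≤ 1`, and `y = diag(e)⁻¹ γ′ diag(e)` is integral and unitary, then
`y ≡ u(y₀₁, y₀₂) (mod ϖ²)`: the entries below the diagonal are `e₀^{±}·O(ϖ²)`-small, the diagonal ones are `≡ 1`, and the `(1,2)` slot is `≡ −σ y₀₁` by unitarity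
(`B₀(y e₁, y e₂) = 0`).  [cite: Tits1979, §3.3.3] [cite: Rogawski1990, §3.9 p. 32] -/
theorem exists_near_heisenberg_of_diag_conj {σ : K →+* K} {ϖ : K} (hd : UnramifiedLocalConjDatum σ ϖ)
    {γ' : Matrix (Fin 3) (Fin 3) K} (hγ' : IsIntMatrix ((ϖ ^ 2)⁻¹ • (γ' - 1))) {e : Fin 3 → K} (he02 : e 0 * e 2 = 1) (he11 : e 1 * e 1 = 1)
    (he0 : Valued.v (e 0) ≤ 1) {y : GL (Fin 3) K} (hyU : y ∈ unitaryGroupOfForm σ ((StdForm.antidiagonal 3).over K))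
    (hyint : IsIntMatrix (y : Matrix (Fin 3) (Fin 3) K)) (hy : ∀ i j, (y : Matrix (Fin 3) (Fin 3) K) i j = (e i)⁻¹ * γ' i j * e j) :
    ∃ α β : K, Valued.v α ≤ 1 ∧ Valued.v β ≤ 1 ∧
      IsIntMatrix ((ϖ ^ 2)⁻¹ • ((y : Matrix (Fin 3) (Fin 3) K) - !![1, α, β; 0, 1, -σ α; 0, 0, 1])) := by
  obtain ⟨hϖ0, hϖ2, hvϖ1, hP1, -⟩ := ϖ_facts hd
  set P := Valued.v (ϖ ^ 2) with hP
  -- the deviation `τ = γ′ − 1`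
  obtain ⟨τ, hτ⟩ : ∃ τ : Matrix (Fin 3) (Fin 3) K, γ' - 1 = τ := ⟨_, rfl⟩
  have hτP : ∀ i j, Valued.v (τ i j) ≤ P := by rw [← hτ, ← isIntMatrix_inv_smul_iff hϖ2]; exact hγ'
  have hγe : ∀ i j, γ' i j = (1 : Matrix (Fin 3) (Fin 3) K) i j + τ i j := fun i j => by rw [← hτ, Matrix.sub_apply]; ring
  -- the frame `e`
  have he0' : e 0 ≠ 0 := fun h => by rw [h, zero_mul] at he02; exact zero_ne_one he02
  have he1' : e 1 ≠ 0 := fun h => by rw [h, zero_mul] at he11; exact zero_ne_one he11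
  have he2 : e 2 = (e 0)⁻¹ := eq_inv_of_mul_eq_one_right he02
  have he1v : Valued.v (e 1) = 1 := by
    have h : Valued.v (e 1) * Valued.v (e 1) = 1 := by rw [← map_mul, he11, map_one]
    have h0 : Valued.v (e 1) ≠ 0 := (Valuation.ne_zero_iff _).2 he1'
    rw [← WithZero.exp_log h0, ← WithZero.exp_add, ← WithZero.exp_zero, WithZero.exp_inj] at h
    rw [← WithZero.exp_log h0, ← WithZero.exp_zero, WithZero.exp_inj]; omega
  have he1i : Valued.v (e 1)⁻¹ = 1 := by rw [map_inv₀, he1v, inv_one]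
  -- the entries of `y`
  have y00 : (y : Matrix (Fin 3) (Fin 3) K) 0 0 = 1 + τ 0 0 := by rw [hy, hγe, Matrix.one_apply_eq]; field_simp
  have y11 : (y : Matrix (Fin 3) (Fin 3) K) 1 1 = 1 + τ 1 1 := by rw [hy, hγe, Matrix.one_apply_eq]; field_simp
  have y22 : (y : Matrix (Fin 3) (Fin 3) K) 2 2 = 1 + τ 2 2 := by
    rw [hy, hγe, Matrix.one_apply_eq, he2]; field_simp
  have y10 : (y : Matrix (Fin 3) (Fin 3) K) 1 0 = (e 1)⁻¹ * τ 1 0 * e 0 := by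
    rw [hy, hγe, Matrix.one_apply_ne (by decide), zero_add]
  have y20 : (y : Matrix (Fin 3) (Fin 3) K) 2 0 = e 0 * τ 2 0 * e 0 := by
    rw [hy, hγe, Matrix.one_apply_ne (by decide), zero_add, he2, inv_inv]
  have y21 : (y : Matrix (Fin 3) (Fin 3) K) 2 1 = e 0 * τ 2 1 * e 1 := by
    rw [hy, hγe, Matrix.one_apply_ne (by decide), zero_add, he2, inv_inv]
  have v10 : Valued.v ((y : Matrix (Fin 3) (Fin 3) K) 1 0) ≤ P := by
    rw [y10]; exact v_mul_le_of_le_of_le_one (v_mul_le_of_le_one_of_le he1i.le (hτP 1 0)) he0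
  have v20 : Valued.v ((y : Matrix (Fin 3) (Fin 3) K) 2 0) ≤ P := by
    rw [y20]; exact v_mul_le_of_le_of_le_one (v_mul_le_of_le_one_of_le he0 (hτP 2 0)) he0
  have v21 : Valued.v ((y : Matrix (Fin 3) (Fin 3) K) 2 1) ≤ P := by
    rw [y21]; exact v_mul_le_of_le_of_le_one (v_mul_le_of_le_one_of_le he0 (hτP 2 1)) he1v.le
  -- unitarity: `B₀(y e₁, y e₂) = 0` gives the `(1,2)` slot
  have hcol : ∀ j : Fin 3, (y : Matrix (Fin 3) (Fin 3) K) *ᵥ (Pi.single j 1 : Fin 3 → K) = fun i => (y : Matrix (Fin 3) (Fin 3) K) i j := fun j => by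
    funext i; simp [Matrix.mulVec, dotProduct, Pi.single_apply]
  have hR : B₀ σ 3 (Pi.single 1 1 : Fin 3 → K) (Pi.single 2 1) = 0 := by rw [B₀_three_apply]; simp
  have hiso := (mem_unitaryGroupOfForm_antidiagonal_iff y).1 hyU (Pi.single 1 1) (Pi.single 2 1)
  rw [hcol, hcol, hR, B₀_three_apply] at hiso
  simp only [y11, y22] at hiso
  -- `hiso : σ y₀₁ (1 + τ₂₂) + σ(1 + τ₁₁) y₁₂ + σ y₂₁ y₀₂ = 0`
  have key : (y : Matrix (Fin 3) (Fin 3) K) 1 2 + σ ((y : Matrix (Fin 3) (Fin 3) K) 0 1) =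
      -(σ ((y : Matrix (Fin 3) (Fin 3) K) 0 1) * τ 2 2 + σ (τ 1 1) * (y : Matrix (Fin 3) (Fin 3) K) 1 2 +
        σ ((y : Matrix (Fin 3) (Fin 3) K) 2 1) * (y : Matrix (Fin 3) (Fin 3) K) 0 2) := by
    simp only [map_add, map_one] at hiso
    linear_combination hiso
  have v12 : Valued.v ((y : Matrix (Fin 3) (Fin 3) K) 1 2 + σ ((y : Matrix (Fin 3) (Fin 3) K) 0 1)) ≤ P := by
    rw [key, Valuation.map_neg]
    refine v_add_le_of_le (v_add_le_of_le ?_ ?_) ?_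
    · exact v_mul_le_of_le_one_of_le (by rw [hd.vσ]; exact hyint 0 1) (hτP 2 2)
    · exact v_mul_le_of_le_of_le_one (by rw [hd.vσ]; exact hτP 1 1) (hyint 1 2)
    · exact v_mul_le_of_le_of_le_one (by rw [hd.vσ]; exact v21) (hyint 0 2)
  refine ⟨(y : Matrix (Fin 3) (Fin 3) K) 0 1, (y : Matrix (Fin 3) (Fin 3) K) 0 2, hyint 0 1, hyint 0 2, ?_⟩
  rw [isIntMatrix_inv_smul_iff hϖ2]
  intro i j
  fin_cases i <;> fin_cases j
  · show Valued.v ((y : Matrix (Fin 3) (Fin 3) K) 0 0 - 1) ≤ P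
    rw [y00, add_sub_cancel_left]; exact hτP 0 0
  · show Valued.v ((y : Matrix (Fin 3) (Fin 3) K) 0 1 - (y : Matrix (Fin 3) (Fin 3) K) 0 1) ≤ P
    rw [sub_self, map_zero]; exact zero_le
  · show Valued.v ((y : Matrix (Fin 3) (Fin 3) K) 0 2 - (y : Matrix (Fin 3) (Fin 3) K) 0 2) ≤ P
    rw [sub_self, map_zero]; exact zero_le
  · show Valued.v ((y : Matrix (Fin 3) (Fin 3) K) 1 0 - 0) ≤ P
    rw [sub_zero]; exact v10
  · show Valued.v ((y : Matrix (Fin 3) (Fin 3) K) 1 1 - 1) ≤ P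
    rw [y11, add_sub_cancel_left]; exact hτP 1 1
  · show Valued.v ((y : Matrix (Fin 3) (Fin 3) K) 1 2 - -σ ((y : Matrix (Fin 3) (Fin 3) K) 0 1)) ≤ P
    rw [sub_neg_eq_add]; exact v12
  · show Valued.v ((y : Matrix (Fin 3) (Fin 3) K) 2 0 - 0) ≤ P
    rw [sub_zero]; exact v20
  · show Valued.v ((y : Matrix (Fin 3) (Fin 3) K) 2 1 - 0) ≤ P
    rw [sub_zero]; exact v21
  · show Valued.v ((y : Matrix (Fin 3) (Fin 3) K) 2 2 - 1) ≤ P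
    rw [y22, add_sub_cancel_left]; exact hτP 2 2

/-- **HEAD (B-bridge) — APARTMENT NORMAL FORM MOD `ϖ²`.** If `γ ∈ U(σ, J₀)` is `2`-deep at `𝒪³` (`γ ≡ 1 mod ϖ²`) and `g ∈ U(σ, J₀)` is such that `x = g⁻¹ γ g` is integral
(`γ` fixes the hyperspecial vertex `g·𝒪³`), then `x` is `K₀`-conjugate mod `ϖ²` to a Heisenberg element `u(α, β)` with integral `α, β`.  Proof: Cartan ★
`UnramifiedLocalConjDatum.exists_cartan_antidiagonal` `k₁ g k₂ = diag(d)`, so `k₂⁻¹ x k₂ = diag(d)⁻¹ (k₁γk₁⁻¹) diag(d)`; after the flip `w = J₀` we may take `v d₀ ≤ 1`,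
and `exists_near_heisenberg_of_diag_conj` applies. [cite: Tits1979, §3.3.3] [cite: Rogawski1990, §3.9 p. 32] -/
theorem exists_levelTwo_conj_near_heisenberg_of_two_deep {σ : K →+* K} {ϖ : K} (hd : UnramifiedLocalConjDatum σ ϖ)
    {γ g x : GL (Fin 3) K} (hγU : γ ∈ unitaryGroupOfForm σ ((StdForm.antidiagonal 3).over K))
    (hγ2 : IsIntMatrix ((ϖ ^ 2)⁻¹ • ((γ : Matrix (Fin 3) (Fin 3) K) - 1)))
    (hgU : g ∈ unitaryGroupOfForm σ ((StdForm.antidiagonal 3).over K)) (hxg : x = g⁻¹ * γ * g) (hxint : IsIntMatrix (x : Matrix (Fin 3) (Fin 3) K)) :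
    ∃ k : GL (Fin 3) K, k ∈ unitaryGroupOfForm σ ((StdForm.antidiagonal 3).over K) ∧ IsIntMatrix (k : Matrix (Fin 3) (Fin 3) K) ∧
      IsIntMatrix ((k⁻¹ : GL (Fin 3) K) : Matrix (Fin 3) (Fin 3) K) ∧
      ∃ α β : K, Valued.v α ≤ 1 ∧ Valued.v β ≤ 1 ∧
        IsIntMatrix ((ϖ ^ 2)⁻¹ • (((k * x * k⁻¹ : GL (Fin 3) K) : Matrix (Fin 3) (Fin 3) K) - !![1, α, β; 0, 1, -σ α; 0, 0, 1])) := by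
  obtain ⟨k₁, k₂, hk₁U, hk₁i, hk₁i', hk₂U, hk₂i, hk₂i', d, hD, hσd, hdd⟩ := hd.exists_cartan_antidiagonal g hgU
  have hxU : x ∈ unitaryGroupOfForm σ ((StdForm.antidiagonal 3).over K) := by rw [hxg]; exact mul_mem (mul_mem (inv_mem hgU) hγU) hgU
  have hd02 : d 0 * d 2 = 1 := hdd 0
  have hd11 : d 1 * d 1 = 1 := hdd 1
  have hd20 : d 2 * d 0 = 1 := hdd 2
  have hdi0 : ∀ i, d i ≠ 0 := fun i h => by have := hdd i; rw [h, zero_mul] at this; exact zero_ne_one this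
  -- `D = k₁ g k₂ = diag(d)` and its inverse
  have hDinv : (((k₁ * g * k₂)⁻¹ : GL (Fin 3) K) : Matrix (Fin 3) (Fin 3) K) = Matrix.diagonal fun i => (d i)⁻¹ := by
    rw [Matrix.coe_units_inv, hD]
    refine Matrix.inv_eq_right_inv ?_
    rw [Matrix.diagonal_mul_diagonal, ← Matrix.diagonal_one]
    congr 1; funext i; exact mul_inv_cancel₀ (hdi0 i)
  -- the `2`-deep element conjugated by `K₀` stays `2`-deep
  have hdeep : ∀ k : GL (Fin 3) K, IsIntMatrix (k : Matrix (Fin 3) (Fin 3) K) → IsIntMatrix ((k⁻¹ : GL (Fin 3) K) : Matrix (Fin 3) (Fin 3) K) →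
      IsIntMatrix ((ϖ ^ 2)⁻¹ • (((k * γ * k⁻¹ : GL (Fin 3) K) : Matrix (Fin 3) (Fin 3) K) - 1)) := fun k hk hk' => by
    rw [Units.val_mul, Units.val_mul]; exact isIntMatrix_smul_conj_sub_one _ hk hk' (Units.mul_inv k) hγ2
  by_cases h0 : Valued.v (d 0) ≤ 1
  · -- no flip: `k = k₂⁻¹`, `y = D⁻¹ (k₁ γ k₁⁻¹) D`
    have hy : k₂⁻¹ * x * k₂⁻¹⁻¹ = (k₁ * g * k₂)⁻¹ * (k₁ * γ * k₁⁻¹) * (k₁ * g * k₂) := by rw [hxg]; group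
    obtain ⟨α, β, hα, hβ, hc⟩ := exists_near_heisenberg_of_diag_conj hd (hdeep k₁ hk₁i hk₁i') (e := d) hd02 hd11 h0
      (y := k₂⁻¹ * x * k₂⁻¹⁻¹) (mul_mem (mul_mem (inv_mem hk₂U) hxU) (inv_mem (inv_mem hk₂U)))
      (by rw [inv_inv, Units.val_mul, Units.val_mul]; exact isIntMatrix_mul (isIntMatrix_mul hk₂i' hxint) hk₂i)
      (fun i j => by rw [hy, Units.val_mul, Units.val_mul, hDinv, hD, Matrix.mul_diagonal, Matrix.diagonal_mul, mul_assoc])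
    exact ⟨k₂⁻¹, inv_mem hk₂U, hk₂i', by rw [inv_inv]; exact hk₂i, α, β, hα, hβ, hc⟩
  · -- flip by `w = J₀`: `k = w k₂⁻¹`, frame `(d₂, d₁, d₀)` with `v d₂ < 1`
    have h2 : Valued.v (d 2) ≤ 1 := by
      have h : Valued.v (d 2) * Valued.v (d 0) = 1 := by rw [← map_mul, hd20, map_one]
      have h0' : Valued.v (d 0) ≠ 0 := (Valuation.ne_zero_iff _).2 (hdi0 0)
      have h2' : Valued.v (d 2) ≠ 0 := (Valuation.ne_zero_iff _).2 (hdi0 2)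
      rw [← WithZero.exp_log h0', ← WithZero.exp_log h2', ← WithZero.exp_add, ← WithZero.exp_zero, WithZero.exp_inj] at h
      rw [← WithZero.exp_log h0', ← WithZero.exp_zero, WithZero.exp_le_exp, not_le] at h0
      rw [← WithZero.exp_log h2', ← WithZero.exp_zero, WithZero.exp_le_exp]
      omega
    obtain ⟨w, hw, hw'⟩ := exists_units_coe_eq_antidiagPerm (K := K)
    have hwU : w ∈ unitaryGroupOfForm σ ((StdForm.antidiagonal 3).over K) := antidiagPerm_mem_unitaryGroupOfForm σ hw
    have hwint : IsIntMatrix (w : Matrix (Fin 3) (Fin 3) K) := by rw [hw]; intro i j; fin_cases i <;> fin_cases j <;> simp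
    have hwint' : IsIntMatrix ((w⁻¹ : GL (Fin 3) K) : Matrix (Fin 3) (Fin 3) K) := by rw [hw']; intro i j; fin_cases i <;> fin_cases j <;> simp
    have hy : w * k₂⁻¹ * x * (w * k₂⁻¹)⁻¹ = (w * (k₁ * g * k₂) * w⁻¹)⁻¹ * ((w * k₁) * γ * (w * k₁)⁻¹) * (w * (k₁ * g * k₂) * w⁻¹) := by
      rw [hxg]; group
    have hD' : ((w * (k₁ * g * k₂) * w⁻¹ : GL (Fin 3) K) : Matrix (Fin 3) (Fin 3) K) = Matrix.diagonal ![d 2, d 1, d 0] := by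
      rw [Units.val_mul, Units.val_mul, hD, hw, hw']
      ext i j
      simp only [Matrix.mul_apply, Fin.sum_univ_three]
      fin_cases i <;> fin_cases j <;> simp [Matrix.diagonal_apply_ne]
    have hD'inv : (((w * (k₁ * g * k₂) * w⁻¹)⁻¹ : GL (Fin 3) K) : Matrix (Fin 3) (Fin 3) K) = Matrix.diagonal fun i => ((![d 2, d 1, d 0] : Fin 3 → K) i)⁻¹ := by
      rw [Matrix.coe_units_inv, hD']
      refine Matrix.inv_eq_right_inv ?_
      rw [Matrix.diagonal_mul_diagonal, ← Matrix.diagonal_one]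
      congr 1; funext i; fin_cases i
      · exact mul_inv_cancel₀ (hdi0 2)
      · exact mul_inv_cancel₀ (hdi0 1)
      · exact mul_inv_cancel₀ (hdi0 0)
    have hwk₁i : IsIntMatrix ((w * k₁ : GL (Fin 3) K) : Matrix (Fin 3) (Fin 3) K) := by rw [Units.val_mul]; exact isIntMatrix_mul hwint hk₁i
    have hwk₁i' : IsIntMatrix (((w * k₁)⁻¹ : GL (Fin 3) K) : Matrix (Fin 3) (Fin 3) K) := by
      rw [_root_.mul_inv_rev, Units.val_mul]; exact isIntMatrix_mul hk₁i' hwint'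
    obtain ⟨α, β, hα, hβ, hc⟩ := exists_near_heisenberg_of_diag_conj hd (hdeep (w * k₁) hwk₁i hwk₁i') (e := ![d 2, d 1, d 0]) hd20 hd11 h2
      (y := w * k₂⁻¹ * x * (w * k₂⁻¹)⁻¹) (mul_mem (mul_mem (mul_mem hwU (inv_mem hk₂U)) hxU) (inv_mem (mul_mem hwU (inv_mem hk₂U))))
      (by rw [_root_.mul_inv_rev, inv_inv, Units.val_mul, Units.val_mul, Units.val_mul, Units.val_mul]
          exact isIntMatrix_mul (isIntMatrix_mul (isIntMatrix_mul hwint hk₂i') hxint) (isIntMatrix_mul hk₂i hwint'))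
      (fun i j => by rw [hy, Units.val_mul, Units.val_mul, hD'inv, hD', Matrix.mul_diagonal, Matrix.diagonal_mul, mul_assoc])
    refine ⟨w * k₂⁻¹, mul_mem hwU (inv_mem hk₂U), ?_, ?_, α, β, hα, hβ, hc⟩
    · rw [Units.val_mul]; exact isIntMatrix_mul hwint hk₂i'
    · rw [_root_.mul_inv_rev, inv_inv, Units.val_mul]; exact isIntMatrix_mul hk₂i hwint'

/-! ## §3 RIGID-2: the two boundary strata -/

/-- **HEAD (B-tv) — RIGID-2, TRANSVECTION TYPE.** For `γ` `2`-deep at `𝒪³` and a `γ`-fixed hyperspecial vertex `g·𝒪³` whose local element `x = g⁻¹ γ g ∈ K₀` is residually a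
transvection (`(x̄ − 1)² = 0 ≠ x̄ − 1`), `x` is `K₀`-conjugate mod `ϖ²` to `n(t₀)` for every skew unit `t₀` — ONE level-2 class on the whole transvection stratum (given
residual norm surjectivity `hN`). [cite: Rogawski1990, §3.9 p. 32] [cite: Tits1979, §3.3.3] -/
theorem levelTwo_conj_cornerUnipotent_of_two_deep {σ : K →+* K} {ϖ : K} (hd : UnramifiedLocalConjDatum σ ϖ) (h2 : Valued.v (2 : K) = 1)
    (hN : ∀ u : K, σ u = u → Valued.v u = 1 → ∃ z : K, Valued.v (z * σ z - u) < 1)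
    {γ g x : GL (Fin 3) K} (hγU : γ ∈ unitaryGroupOfForm σ ((StdForm.antidiagonal 3).over K))
    (hγ2 : IsIntMatrix ((ϖ ^ 2)⁻¹ • ((γ : Matrix (Fin 3) (Fin 3) K) - 1)))
    (hgU : g ∈ unitaryGroupOfForm σ ((StdForm.antidiagonal 3).over K)) (hxg : x = g⁻¹ * γ * g) (hxint : IsIntMatrix (x : Matrix (Fin 3) (Fin 3) K))
    (hx1 : ¬ IsIntMatrix (ϖ⁻¹ • ((x : Matrix (Fin 3) (Fin 3) K) - 1))) (hx2 : IsIntMatrix (ϖ⁻¹ • ((x : Matrix (Fin 3) (Fin 3) K) - 1) ^ 2))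
    {t₀ : K} (ht₀ : σ t₀ + t₀ = 0) (ht₀v : Valued.v t₀ = 1) :
    ∃ k : GL (Fin 3) K, k ∈ unitaryGroupOfForm σ ((StdForm.antidiagonal 3).over K) ∧ IsIntMatrix (k : Matrix (Fin 3) (Fin 3) K) ∧
      IsIntMatrix ((k⁻¹ : GL (Fin 3) K) : Matrix (Fin 3) (Fin 3) K) ∧
      IsIntMatrix ((ϖ ^ 2)⁻¹ • (((k * x * k⁻¹ : GL (Fin 3) K) : Matrix (Fin 3) (Fin 3) K) - !![1, 0, t₀; 0, 1, 0; 0, 0, 1])) := by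
  have hxU : x ∈ unitaryGroupOfForm σ ((StdForm.antidiagonal 3).over K) := by rw [hxg]; exact mul_mem (mul_mem (inv_mem hgU) hγU) hgU
  obtain ⟨k, hkU, hki, hki', α, β, hα1, hβ1, hk⟩ := exists_levelTwo_conj_near_heisenberg_of_two_deep hd hγU hγ2 hgU hxg hxint
  have hyU : k * x * k⁻¹ ∈ unitaryGroupOfForm σ ((StdForm.antidiagonal 3).over K) := mul_mem (mul_mem hkU hxU) (inv_mem hkU)
  -- residual type transport along `k`
  have hy2 : IsIntMatrix (ϖ⁻¹ • (((k * x * k⁻¹ : GL (Fin 3) K) : Matrix (Fin 3) (Fin 3) K) - 1) ^ 2) := by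
    rw [Units.val_mul, Units.val_mul]; exact isIntMatrix_smul_conj_sub_one_sq _ hki hki' (Units.mul_inv k) (Units.inv_mul k) hx2
  have hy1 : ¬ IsIntMatrix (ϖ⁻¹ • (((k * x * k⁻¹ : GL (Fin 3) K) : Matrix (Fin 3) (Fin 3) K) - 1)) := fun h => hx1 (by
    have h' := isIntMatrix_smul_conj_sub_one _ hki' hki (Units.inv_mul k) h
    rwa [Units.val_mul, Units.val_mul, show ((k⁻¹ : GL (Fin 3) K) : Matrix (Fin 3) (Fin 3) K) * ((k : Matrix (Fin 3) (Fin 3) K) *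
      (x : Matrix (Fin 3) (Fin 3) K) * ((k⁻¹ : GL (Fin 3) K) : Matrix (Fin 3) (Fin 3) K)) * (k : Matrix (Fin 3) (Fin 3) K) = x by
      rw [← Units.val_mul, ← Units.val_mul, ← Units.val_mul, ← Units.val_mul]; congr 1; group] at h')
  have hα : Valued.v α < 1 := by
    have h := (isIntMatrix_inv_smul_sub_one_sq_iff_of_near_heisenberg hd hα1 hβ1 hk).1 hy2
    by_contra hα'
    have hα1' : Valued.v α = 1 := le_antisymm hα1 (not_lt.1 hα')
    rw [map_mul, hd.vσ, hα1', one_mul] at h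
    exact absurd h (not_le.2 (ϖ_facts hd).2.2.1)
  have hβ : Valued.v β = 1 := v_corner_eq_one_of_near_heisenberg hd hα hβ1 hk hy1
  obtain ⟨k', hk'U, hk'i, hk'i', hc⟩ := levelTwo_conj_cornerUnipotent_of_near_heisenberg hd h2 hN hyU hα hβ hk ht₀ ht₀v
  refine ⟨k' * k, mul_mem hk'U hkU, ?_, ?_, ?_⟩
  · rw [Units.val_mul]; exact isIntMatrix_mul hk'i hki
  · rw [_root_.mul_inv_rev, Units.val_mul]; exact isIntMatrix_mul hki' hk'i'
  · rwa [show k' * k * x * (k' * k)⁻¹ = k' * (k * x * k⁻¹) * k'⁻¹ by group]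

/-- **HEAD (B-reg) — RIGID-2, REGULAR TYPE.** For `γ` `2`-deep at `𝒪³` and a `γ`-fixed hyperspecial vertex whose local element `x ∈ K₀` is residually REGULAR unipotent
(`(x̄ − 1)² ≠ 0`), `x` is `K₀`-conjugate mod `ϖ²` to the reference `u(1, b₀)` — ONE level-2 class on the regular stratum (no norm hypothesis).
[cite: Rogawski1990, §3.9 Prop. 3.9.1 p. 32] [cite: Tits1979, §3.3.3] -/
theorem levelTwo_conj_upperUnipotent_one_of_two_deep {σ : K →+* K} {ϖ : K} (hd : UnramifiedLocalConjDatum σ ϖ) (h2 : Valued.v (2 : K) = 1)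
    {γ g x : GL (Fin 3) K} (hγU : γ ∈ unitaryGroupOfForm σ ((StdForm.antidiagonal 3).over K))
    (hγ2 : IsIntMatrix ((ϖ ^ 2)⁻¹ • ((γ : Matrix (Fin 3) (Fin 3) K) - 1)))
    (hgU : g ∈ unitaryGroupOfForm σ ((StdForm.antidiagonal 3).over K)) (hxg : x = g⁻¹ * γ * g) (hxint : IsIntMatrix (x : Matrix (Fin 3) (Fin 3) K))
    (hxreg : ¬ IsIntMatrix (ϖ⁻¹ • ((x : Matrix (Fin 3) (Fin 3) K) - 1) ^ 2))
    {b₀ : K} (hb₀ : b₀ + σ b₀ + 1 = 0) (hb₀v : Valued.v b₀ ≤ 1) :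
    ∃ k : GL (Fin 3) K, k ∈ unitaryGroupOfForm σ ((StdForm.antidiagonal 3).over K) ∧ IsIntMatrix (k : Matrix (Fin 3) (Fin 3) K) ∧
      IsIntMatrix ((k⁻¹ : GL (Fin 3) K) : Matrix (Fin 3) (Fin 3) K) ∧
      IsIntMatrix ((ϖ ^ 2)⁻¹ • (((k * x * k⁻¹ : GL (Fin 3) K) : Matrix (Fin 3) (Fin 3) K) - !![1, 1, b₀; 0, 1, -1; 0, 0, 1])) := by
  have hxU : x ∈ unitaryGroupOfForm σ ((StdForm.antidiagonal 3).over K) := by rw [hxg]; exact mul_mem (mul_mem (inv_mem hgU) hγU) hgU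
  obtain ⟨k, hkU, hki, hki', α, β, hα1, hβ1, hk⟩ := exists_levelTwo_conj_near_heisenberg_of_two_deep hd hγU hγ2 hgU hxg hxint
  have hyU : k * x * k⁻¹ ∈ unitaryGroupOfForm σ ((StdForm.antidiagonal 3).over K) := mul_mem (mul_mem hkU hxU) (inv_mem hkU)
  have hyreg : ¬ IsIntMatrix (ϖ⁻¹ • (((k * x * k⁻¹ : GL (Fin 3) K) : Matrix (Fin 3) (Fin 3) K) - 1) ^ 2) := fun h => hxreg (by
    have h' := isIntMatrix_smul_conj_sub_one_sq _ hki' hki (Units.inv_mul k) (Units.mul_inv k) h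
    rwa [Units.val_mul, Units.val_mul, show ((k⁻¹ : GL (Fin 3) K) : Matrix (Fin 3) (Fin 3) K) * ((k : Matrix (Fin 3) (Fin 3) K) *
      (x : Matrix (Fin 3) (Fin 3) K) * ((k⁻¹ : GL (Fin 3) K) : Matrix (Fin 3) (Fin 3) K)) * (k : Matrix (Fin 3) (Fin 3) K) = x by
      rw [← Units.val_mul, ← Units.val_mul, ← Units.val_mul, ← Units.val_mul]; congr 1; group] at h')
  have hα : Valued.v α = 1 := by
    by_contra hα'
    have hαϖ := v_le_ϖ_of_lt_one hd (lt_of_le_of_ne hα1 hα')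
    exact hyreg ((isIntMatrix_inv_smul_sub_one_sq_iff_of_near_heisenberg hd hα1 hβ1 hk).2
      (v_mul_le_of_le_of_le_one hαϖ (by rw [hd.vσ]; exact hα1)))
  obtain ⟨k', hk'U, hk'i, hk'i', hc⟩ := levelTwo_conj_upperUnipotent_one_of_near_heisenberg hd h2 hyU hα hβ1 hk hb₀ hb₀v
  refine ⟨k' * k, mul_mem hk'U hkU, ?_, ?_, ?_⟩
  · rw [Units.val_mul]; exact isIntMatrix_mul hk'i hki
  · rw [_root_.mul_inv_rev, Units.val_mul]; exact isIntMatrix_mul hki' hk'i'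
  · rwa [show k' * k * x * (k' * k)⁻¹ = k' * (k * x * k⁻¹) * k'⁻¹ by group]

/-! ## §4 Adapter to level-two class functions -/

/-- **From a level-2 conjugacy to a level-2 unit factor**: if `y ≡ n (mod c⁻¹)` with `n⁻¹` integral then `y = u·n` with `u = y n⁻¹ ≡ 1 (mod c⁻¹)` — so a function on `K₀`
that is left-invariant under the level-2 congruence subgroup and conjugation-invariant takes the same value at `x` and at the reference element. [cite: Tits1979, §3.5] -/
theorem isIntMatrix_smul_mul_inv_sub_one {N : ℕ} (c : K) {y n : GL (Fin N) K} (hn' : IsIntMatrix ((n⁻¹ : GL (Fin N) K) : Matrix (Fin N) (Fin N) K))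
    (h : IsIntMatrix (c • ((y : Matrix (Fin N) (Fin N) K) - (n : Matrix (Fin N) (Fin N) K)))) :
    IsIntMatrix (c • (((y * n⁻¹ : GL (Fin N) K) : Matrix (Fin N) (Fin N) K) - 1)) := by
  have he : ((y * n⁻¹ : GL (Fin N) K) : Matrix (Fin N) (Fin N) K) - 1 =
      ((y : Matrix (Fin N) (Fin N) K) - (n : Matrix (Fin N) (Fin N) K)) * ((n⁻¹ : GL (Fin N) K) : Matrix (Fin N) (Fin N) K) := by
    rw [Matrix.sub_mul, ← Units.val_mul, ← Units.val_mul, mul_inv_cancel, Units.val_one]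
  rw [he, ← Matrix.smul_mul]
  exact isIntMatrix_mul h hn'

/-- The same with the unit factor on the right: `y = n·u′`, `u′ = n⁻¹ y ≡ 1 (mod c⁻¹)`. [cite: Tits1979, §3.5] -/
theorem isIntMatrix_smul_inv_mul_sub_one {N : ℕ} (c : K) {y n : GL (Fin N) K} (hn' : IsIntMatrix ((n⁻¹ : GL (Fin N) K) : Matrix (Fin N) (Fin N) K))
    (h : IsIntMatrix (c • ((y : Matrix (Fin N) (Fin N) K) - (n : Matrix (Fin N) (Fin N) K)))) :
    IsIntMatrix (c • (((n⁻¹ * y : GL (Fin N) K) : Matrix (Fin N) (Fin N) K) - 1)) := by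
  have he : ((n⁻¹ * y : GL (Fin N) K) : Matrix (Fin N) (Fin N) K) - 1 =
      ((n⁻¹ : GL (Fin N) K) : Matrix (Fin N) (Fin N) K) * ((y : Matrix (Fin N) (Fin N) K) - (n : Matrix (Fin N) (Fin N) K)) := by
    rw [Matrix.mul_sub, ← Units.val_mul, ← Units.val_mul, inv_mul_cancel, Units.val_one]
  rw [he, ← Matrix.mul_smul]
  exact isIntMatrix_mul hn' h

end Literature.NumberTheory.Automorphic.UnitaryGroup
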